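import Summits.QuantumFields.BalabanUV.Beta.GAN24.DerivativeRateTransferAnalyticMixed
import Summits.QuantumFields.BalabanUV.Beta.GAN24.DerivativeRateTransfer

/-!
# `BalabanUV.Beta.GAN24.DerivativeRateTransferAnalyticConvC` — binder row G-an2-4 ∕ (CONV-C), route R6 «VALUES, NOT DERIVATIVES», PART 9:
# THE ANALYTIC ROUTE'S ENDs IN THE CELL'S (CONV-C) CURRENCY `GAN24.DirichletExhaustion.ConvC` — S5∕S6 bookkeeping with a FREE
# interpolation exponent `τ`: [decay-free geometric rate `a·ϑ^k`] ∧ [(H2)-ker decay `C₂e^{−δ₂|p−q|}`] ⇒ `ConvC` with `(ϑ^{1−τ}, τ·δ₂)` for EVERY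
# `τ ∈ [0,1]` (the tree's `decay_interp` is `τ = ½`), instantiated on PART 7 (first order, pure second order) and PART 8 (MIXED second
# order): the u-rows of the two-bond family meet BOTH clauses of (CONV-C) with ratio `θ^{(1−r)(1−τ)}` resp. `θ^{(1−r)(1−r′)(1−τ)}` —
# exponent loss as small as one likes, paid in the constant (unit b2b-balaban-gan24-p3, gen 34; v1)

NOT IN PRINT; OUR PROOF (for the ROUTE; [folklore] real∕complex analysis — PART 7 `deriv_step_rateω` ∕ `deriv₂_step_rateω`, PART 8
`derivMixed_step_rateω`, PART 1 `exp_weight_mono` BY NAME; Mathlib `Real.rpow`).  HONEST FRAMING (cell contract, verbatim): «discharging `BetaPertH`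
makes Bałaban's UV stability UNCONDITIONAL — a real constructive-QFT result; it is NOT the continuum limit and NOT the Clay problem.»  HONEST DEPENDENCY
(verbatim): «continuum YM on T⁴ ⇐ BetaPertH ∧ nine spine estimates (0/9 proved); BetaPertH ⇐ (D1) ∧ (D4) ∧ CAP+tail; G-an2-4 gates asym, D1 and NE2/3/4.»

WHY THIS FILE.  PART 1 (`DerivativeRateTransfer`, p257089) closed route R6 in the cell's (CONV-C) predicate for the REAL-Taylor transfer:
`convC_deriv₁ : TransferInput₁ ∧ (H2)-ker decay ⇒ ConvC dF … (δ₂∕2) (θ^{1∕4})`, the decay joined by the geometric mean `decay_interp` (`τ = ½`).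
PARTs 7–8 replaced the real-Taylor input by ANALYTICITY (exponent `θ^{1−r}`, resp. `(θ^{1−r})^{1−r′}` for the mixed rows) but stopped at the
decay-free rate.  ROUTES-GAN24 v26 «R6 — v26 NOTE»: «`decay_interp` generalises for free to `|x| ≤ A`, `|x| ≤ B·e^{−δℓ}` ⇒
`|x| ≤ A^{1−τ}B^{τ}e^{−τδℓ}` for EVERY `τ ∈ (0, 1]` … so the u-rows meet the (CONV-C) shape with `(θ₄, δ₄) = (θ^{1−τ}, τδ)` for every `τ` —
R6's exponent loss is NOT intrinsic».  THIS FILE makes that sentence kernel and joins it to PARTs 7–8: the analytic route's ENDs in the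
literal `ConvC` currency, for the first-order rows, the pure second-order rows and the MIXED second-order rows of the two-bond family.

WHAT THIS FILE PROVES (0 sorry, 0 `def`):
* §1 [folklore] `decay_interp_rpow` (`|x| ≤ A`, `|x| ≤ B·w`, `τ ∈ [0,1]` ⇒ `|x| ≤ A^{1−τ}·B^τ·w^τ`), `exp_rpow_weight` (`(e^{−δd})^τ = e^{−τδd}`);
* §2 **`convC_of_rate_of_decay`** — THE S5 BOOKKEEPING, ANY RATE SOURCE: real kernels `dF k` on `K D N = ℤ^D × Fin N` with (H2)-ker decay
  `|dF k p q| ≤ C₂e^{−δ₂|p−q|}` (`δ₂ ≥ 0`) and a decay-free one-step rate `|dF (k+1) p q − dF k p q| ≤ a·ϑ^k` (`a, ϑ ≥ 0`) satisfy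
  `ConvC dF (max C₂ (a^{1−τ}·(2C₂)^τ)) (τ·δ₂) (ϑ^{1−τ})` for EVERY `τ ∈ [0,1]`;
* §3 THE ANALYTIC ENDs (uniformly-in-`(k,p,q)` hypotheses of PARTs 7∕8 + the identification `(dF k p q : ℂ) = ∂F_k(p,q)(0)` + (H2)-ker decay):
  **`convC_derivω`** (first order; ratio `(θ^{1−r})^{1−τ}`), **`convC_deriv₂ω`** (pure second order; `((θ^{1−r})^{1−r})^{1−τ}`),
  **`convC_derivMixedω`** (MIXED second order on the bidisc; `((θ^{1−r})^{1−r′})^{1−τ}`);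
* §4 the ∃-currency ENDs `exists_convC_derivω` ∕ `exists_convC_derivMixedω` (`∃ C₄ δ₄ θ₄, 0 < δ₄ ∧ 0 ≤ θ₄ ∧ θ₄ < 1 ∧ ConvC …`, from
  `r = r′ = τ = ½`; `δ₄ = δ₂∕2`) — the shape every typed consumer takes (`ConvCK` ∕ `ConvCKWall` ∕ `LimitForm.conv`: ∃θ < 1).
WHAT IT DOES NOT DO: supply S1 (the value rate WITH BACKGROUND, uniformly in the entry and on the real segment∕square — THE debt, NE2-P2's
with-background END), S2 (the Bałaban-instance dictionary: analyticity + ONE bound on a complex disc∕bidisc uniformly in `(k,p,q)` — the printed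
KIND is [Balaban1985BackgroundPropagators] Thm 3.4, CONTEXT only), the (H2)-ker decay of the derivative entries (an2's (H2)), or the Table-T
identification S6∕S7.  SUPPLIER work on route R6 (rank 2, KEEP-AS-REDUCTION, no seat); no consumer of record; NOT one of the nine spine estimates;
NEVER «G-an2-4 closed»; NOT (CONV-C) (a list over Bałaban's constituents — here three abstract row SHAPES), NOT D1, NOT `BetaPertH`, NOT
continuum, NOT Clay.  Records: `HOME/b2b-balaban-gan24-p3/WOODBURY-FIBRE.md` v13.4, `HOME/beta/ROUTES-GAN24.md` v26 «R6 — v26 NOTE» (gan24-idea-1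
g27, whose `τ`-sentence this file executes, with credit).
-/

noncomputable section
open Set Metric

namespace Summit.QuantumFields.BalabanUV.Beta.GAN24.DerivativeRateTransferAnalyticConvC

open Summit.QuantumFields.BalabanUV.Beta.GAN24.DirichletExhaustion (ConvC)
open Literature.MathematicalPhysics.QuantumFieldTheory.Balaban1983to89.B4Sect5Exhaustion (K)
open Summit.QuantumFields.BalabanUV.Beta.GAN24.DerivativeRateTransfer (exp_weight_mono)
open Summit.QuantumFields.BalabanUV.Beta.GAN24.DerivativeRateTransferAnalytic
  (rho_pos rpow_geom deriv_step_rateω deriv₂_step_rateω)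
open Summit.QuantumFields.BalabanUV.Beta.GAN24.DerivativeRateTransferAnalyticMixed (const₁_pos derivMixed_step_rateω)

/-! ## §1 Interpolation of a rate against a decay bound with a free exponent `τ` -/

/-- [folklore] **DECAY BY INTERPOLATION WITH A FREE EXPONENT**: `|x| ≤ A` and `|x| ≤ B·w` (`A, B, w ≥ 0`) give, for every `τ ∈ [0,1]`,
`|x| ≤ A^{1−τ}·B^τ·w^τ` (`|x| = |x|^{1−τ}·|x|^τ`). With `A` a decay-free rate and `B·w = C·e^{−δℓ}` a rate-free decay bound this is
ROUTES-GAN24 «R6 — v26 NOTE»'s `|x| ≤ A^{1−τ}B^{τ}e^{−τδℓ}`; PART 1's `decay_interp` is `τ = ½`. -/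
theorem decay_interp_rpow {x A B w τ : ℝ} (hA : |x| ≤ A) (hB : |x| ≤ B * w) (h0A : 0 ≤ A) (h0B : 0 ≤ B) (h0w : 0 ≤ w)
    (hτ0 : 0 ≤ τ) (hτ1 : τ ≤ 1) : |x| ≤ A ^ (1 - τ) * B ^ τ * w ^ τ := by
  have hx : 0 ≤ |x| := abs_nonneg x
  have h1 : |x| ^ (1 - τ) ≤ A ^ (1 - τ) := Real.rpow_le_rpow hx hA (by linarith)
  have h2 : |x| ^ τ ≤ (B * w) ^ τ := Real.rpow_le_rpow hx hB hτ0
  calc |x| = |x| ^ ((1 - τ) + τ) := by rw [sub_add_cancel, Real.rpow_one]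
    _ = |x| ^ (1 - τ) * |x| ^ τ := Real.rpow_add' hx (by norm_num)
    _ ≤ A ^ (1 - τ) * (B * w) ^ τ := mul_le_mul h1 h2 (Real.rpow_nonneg hx _) (Real.rpow_nonneg h0A _)
    _ = A ^ (1 - τ) * B ^ τ * w ^ τ := by rw [Real.mul_rpow h0B h0w]; ring

/-- [folklore] the exponential weight under a real power: `(e^{−δd})^τ = e^{−(τδ)d}`. -/
theorem exp_rpow_weight (δ d τ : ℝ) : Real.exp (-(δ * d)) ^ τ = Real.exp (-(τ * δ * d)) := by
  rw [← Real.exp_mul]; congr 1; ring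

/-! ## §2 The S5 bookkeeping for ANY rate source: decay-free rate + (H2)-ker decay ⇒ `ConvC`, exponent `τ` free -/

section Bookkeeping

variable {D N : ℕ}

/-- **`convC_of_rate_of_decay` — (CONV-C) FROM A DECAY-FREE RATE AND A RATE-FREE DECAY, FOR EVERY `τ ∈ [0,1]`** [our proof; [folklore]]: real
kernels `dF k` on `K D N = ℤ^D × Fin N` with `|dF k p q| ≤ C₂·e^{−δ₂|p−q|}` (all `k`; `δ₂ ≥ 0`) and `|dF (k+1) p q − dF k p q| ≤ a·ϑ^k`
(`a, ϑ ≥ 0`) satisfy `ConvC dF (max C₂ (a^{1−τ}·(2C₂)^τ)) (τ·δ₂) (ϑ^{1−τ})`: the first clause by monotonicity of the weight (`τδ₂ ≤ δ₂`), the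
second by `decay_interp_rpow` against `|dF (k+1) − dF k| ≤ 2C₂e^{−δ₂|p−q|}`. -/
theorem convC_of_rate_of_decay {dF : ℕ → K D N → K D N → ℝ} {C₂ δ₂ a ϑ τ : ℝ}
    (hdecay : ∀ k (p q : K D N), |dF k p q| ≤ C₂ * Real.exp (-(δ₂ * dist p.1 q.1)))
    (hrate : ∀ k (p q : K D N), |dF (k + 1) p q - dF k p q| ≤ a * ϑ ^ k)
    (ha : 0 ≤ a) (hϑ : 0 ≤ ϑ) (hδ₂ : 0 ≤ δ₂) (hτ0 : 0 ≤ τ) (hτ1 : τ ≤ 1) :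
    ConvC dF (max C₂ (a ^ (1 - τ) * (2 * C₂) ^ τ)) (τ * δ₂) (ϑ ^ (1 - τ)) := by
  -- `0 ≤ C₂` is read off the decay bound at a diagonal entry (the index set is inhabited inside each clause)
  have hC₂_of : ∀ (k : ℕ) (p : K D N), 0 ≤ C₂ := fun k p => by
    have h := hdecay k p p
    rw [dist_self, mul_zero, neg_zero, Real.exp_zero, mul_one] at h
    exact (abs_nonneg _).trans h
  have hτδ : τ * δ₂ ≤ δ₂ := by nlinarith
  refine ⟨fun k p q => ?_, fun k p q => ?_⟩
  · have hC₂ := hC₂_of k p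
    calc |dF k p q| ≤ C₂ * Real.exp (-(δ₂ * dist p.1 q.1)) := hdecay k p q
      _ ≤ C₂ * Real.exp (-(τ * δ₂ * dist p.1 q.1)) :=
          mul_le_mul_of_nonneg_left (exp_weight_mono hτδ dist_nonneg) hC₂
      _ ≤ max C₂ (a ^ (1 - τ) * (2 * C₂) ^ τ) * Real.exp (-(τ * δ₂ * dist p.1 q.1)) :=
          mul_le_mul_of_nonneg_right (le_max_left _ _) (Real.exp_nonneg _)
  · have hC₂ := hC₂_of k p
    have hA : |dF (k + 1) p q - dF k p q| ≤ a * ϑ ^ k := hrate k p q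
    have hB : |dF (k + 1) p q - dF k p q| ≤ 2 * C₂ * Real.exp (-(δ₂ * dist p.1 q.1)) := by
      calc |dF (k + 1) p q - dF k p q| ≤ |dF (k + 1) p q| + |dF k p q| := abs_sub _ _
        _ ≤ C₂ * Real.exp (-(δ₂ * dist p.1 q.1)) + C₂ * Real.exp (-(δ₂ * dist p.1 q.1)) :=
            add_le_add (hdecay _ _ _) (hdecay _ _ _)
        _ = 2 * C₂ * Real.exp (-(δ₂ * dist p.1 q.1)) := by ring
    have key := decay_interp_rpow hA hB (by positivity) (by positivity) (Real.exp_nonneg _) hτ0 hτ1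
    rw [rpow_geom ha hϑ τ k, exp_rpow_weight] at key
    calc |dF (k + 1) p q - dF k p q|
        ≤ a ^ (1 - τ) * (ϑ ^ (1 - τ)) ^ k * (2 * C₂) ^ τ * Real.exp (-(τ * δ₂ * dist p.1 q.1)) := key
      _ = a ^ (1 - τ) * (2 * C₂) ^ τ * (ϑ ^ (1 - τ)) ^ k * Real.exp (-(τ * δ₂ * dist p.1 q.1)) := by ring
      _ ≤ max C₂ (a ^ (1 - τ) * (2 * C₂) ^ τ) * (ϑ ^ (1 - τ)) ^ k * Real.exp (-(τ * δ₂ * dist p.1 q.1)) := by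
          have : 0 ≤ (ϑ ^ (1 - τ)) ^ k := pow_nonneg (Real.rpow_nonneg hϑ _) k
          gcongr
          exact le_max_right _ _

/-- [folklore] the ratio of `convC_of_rate_of_decay` is an honest geometric ratio: `0 ≤ ϑ < 1`, `τ < 1` ⇒ `ϑ^{1−τ} < 1`. -/
theorem ratio_rpow_lt_one {ϑ τ : ℝ} (h0 : 0 ≤ ϑ) (h1 : ϑ < 1) (hτ1 : τ < 1) : ϑ ^ (1 - τ) < 1 :=
  Real.rpow_lt_one h0 h1 (by linarith)

end Bookkeeping

/-! ## §3 The analytic route's ENDs in the `ConvC` currency: first order, pure second order, MIXED second order -/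

section AnalyticEnds

variable {D N : ℕ}

/-- [folklore] the identification `(dF : ℂ) = z`, `(dF′ : ℂ) = z′` turns `|dF′ − dF|` into `‖z′ − z‖`. -/
theorem abs_sub_eq_norm_of_ofReal_eq {a b : ℝ} {z w : ℂ} (ha : (a : ℂ) = z) (hb : (b : ℂ) = w) : |a - b| = ‖z - w‖ := by
  rw [← ha, ← hb, ← Complex.ofReal_sub, Complex.norm_real, Real.norm_eq_abs]

/-- **`convC_derivω` — (CONV-C) FOR A FIRST-ORDER u-ROW, ANALYTIC ROUTE** [our proof]: complex entry families `F k p q : ℂ → ℂ` holomorphic on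
`ball 0 ρ` with `‖F k p q‖ ≤ B` there (uniformly in `(k,p,q)`; `0 ≤ B`), value rate `‖F (k+1) p q s − F k p q s‖ ≤ c·θ^k` on the real segment
`[0,s₁]` (uniformly in `(p,q)`; `0 < c`, `0 < θ`; `0 < s₁`, `s₁·cosh 1 < ρ`), real kernels `dF k p q` IDENTIFIED with the derivatives at the base
point (`(dF k p q : ℂ) = deriv (F k p q) 0`) and obeying the (H2)-ker decay `|dF k p q| ≤ C₂e^{−δ₂|p−q|}` (`δ₂ ≥ 0`): for all `r ∈ ]0,1]`,
`τ ∈ [0,1]`, `ConvC dF (max C₂ (A^{1−τ}(2C₂)^τ)) (τδ₂) ((θ^{1−r})^{1−τ})`, `A = 25(2B)^r∕(s₁r²)·c^{1−r}` (PART 7 `deriv_step_rateω` + §2). -/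
theorem convC_derivω {F : ℕ → K D N → K D N → ℂ → ℂ} {dF : ℕ → K D N → K D N → ℝ} {ρ s₁ B c θ C₂ δ₂ : ℝ}
    (hs₁ : 0 < s₁) (hs₁ρ : s₁ * Real.cosh 1 < ρ)
    (hF : ∀ k p q, DifferentiableOn ℂ (F k p q) (ball (0 : ℂ) ρ))
    (hB : ∀ k p q, ∀ z ∈ ball (0 : ℂ) ρ, ‖F k p q z‖ ≤ B) (hB0 : 0 ≤ B)
    (hval : ∀ k p q (s : ℝ), 0 ≤ s → s ≤ s₁ → ‖F (k + 1) p q (s : ℂ) - F k p q (s : ℂ)‖ ≤ c * θ ^ k)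
    (hc : 0 < c) (hθ : 0 < θ)
    (hdF : ∀ k p q, (dF k p q : ℂ) = deriv (F k p q) 0)
    (hdecay : ∀ k (p q : K D N), |dF k p q| ≤ C₂ * Real.exp (-(δ₂ * dist p.1 q.1))) (hδ₂ : 0 ≤ δ₂)
    {r τ : ℝ} (hr : 0 < r) (hr1 : r ≤ 1) (hτ0 : 0 ≤ τ) (hτ1 : τ ≤ 1) :
    ConvC dF (max C₂ ((25 * (2 * B) ^ r / (s₁ * r ^ 2) * c ^ (1 - r)) ^ (1 - τ) * (2 * C₂) ^ τ))
      (τ * δ₂) ((θ ^ (1 - r)) ^ (1 - τ)) := by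
  refine convC_of_rate_of_decay hdecay (fun k p q => ?_) ?_ (Real.rpow_nonneg hθ.le _) hδ₂ hτ0 hτ1
  · rw [abs_sub_eq_norm_of_ofReal_eq (hdF (k + 1) p q) (hdF k p q)]
    exact deriv_step_rateω (F := fun k => F k p q) hs₁ hs₁ρ (fun k => hF k p q) (fun k => hB k p q)
      (fun k s hs0 hs1 => hval k p q s hs0 hs1) hc hθ hr hr1 k
  · have : 0 ≤ (2 * B) ^ r := Real.rpow_nonneg (by linarith) r
    have : 0 ≤ c ^ (1 - r) := Real.rpow_nonneg hc.le _
    positivity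

/-- **`convC_deriv₂ω` — (CONV-C) FOR A PURE SECOND-ORDER u-ROW (`b = b′`), ANALYTIC ROUTE** [our proof]: as `convC_derivω` with `0 < B` and the
identification `(d2F k p q : ℂ) = deriv (deriv (F k p q)) 0`: for all `r ∈ ]0,1]`, `τ ∈ [0,1]`,
`ConvC d2F (max C₂ (A₂^{1−τ}(2C₂)^τ)) (τδ₂) (((θ^{1−r})^{1−r})^{1−τ})` with `A₂` PART 7's `deriv₂_step_rateω` constant. -/
theorem convC_deriv₂ω {F : ℕ → K D N → K D N → ℂ → ℂ} {d2F : ℕ → K D N → K D N → ℝ} {ρ s₁ B c θ C₂ δ₂ : ℝ}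
    (hs₁ : 0 < s₁) (hs₁ρ : s₁ * Real.cosh 1 < ρ)
    (hF : ∀ k p q, DifferentiableOn ℂ (F k p q) (ball (0 : ℂ) ρ))
    (hB : ∀ k p q, ∀ z ∈ ball (0 : ℂ) ρ, ‖F k p q z‖ ≤ B) (hB0 : 0 < B)
    (hval : ∀ k p q (s : ℝ), 0 ≤ s → s ≤ s₁ → ‖F (k + 1) p q (s : ℂ) - F k p q (s : ℂ)‖ ≤ c * θ ^ k)
    (hc : 0 < c) (hθ : 0 < θ)
    (hd2F : ∀ k p q, (d2F k p q : ℂ) = deriv (deriv (F k p q)) 0)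
    (hdecay : ∀ k (p q : K D N), |d2F k p q| ≤ C₂ * Real.exp (-(δ₂ * dist p.1 q.1))) (hδ₂ : 0 ≤ δ₂)
    {r τ : ℝ} (hr : 0 < r) (hr1 : r ≤ 1) (hτ0 : 0 ≤ τ) (hτ1 : τ ≤ 1) :
    ConvC d2F (max C₂ ((25 * ((25 * c ^ (1 - r) * (2 * B) ^ r / (s₁ / 2 * r ^ 2)) ^ (1 - r)
        * (2 * (2 * B) / (ρ - s₁ * Real.cosh 1)) ^ r) / (s₁ / 2 * r ^ 2)) ^ (1 - τ) * (2 * C₂) ^ τ))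
      (τ * δ₂) (((θ ^ (1 - r)) ^ (1 - r)) ^ (1 - τ)) := by
  refine convC_of_rate_of_decay hdecay (fun k p q => ?_) ?_
    (Real.rpow_nonneg (Real.rpow_nonneg hθ.le _) _) hδ₂ hτ0 hτ1
  · rw [abs_sub_eq_norm_of_ofReal_eq (hd2F (k + 1) p q) (hd2F k p q)]
    exact deriv₂_step_rateω (F := fun k => F k p q) hs₁ hs₁ρ (fun k => hF k p q) (fun k => hB k p q) hB0
      (fun k s hs0 hs1 => hval k p q s hs0 hs1) hc hθ hr hr1 k
  · have h1 : 0 ≤ (25 * c ^ (1 - r) * (2 * B) ^ r / (s₁ / 2 * r ^ 2)) ^ (1 - r) :=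
      Real.rpow_nonneg (by
        have : 0 ≤ c ^ (1 - r) := Real.rpow_nonneg hc.le _
        have : 0 ≤ (2 * B) ^ r := Real.rpow_nonneg (by linarith) r
        positivity) _
    have h2 : 0 ≤ (2 * (2 * B) / (ρ - s₁ * Real.cosh 1)) ^ r :=
      Real.rpow_nonneg (div_pos (by linarith) (by linarith)).le _
    positivity

/-- **`convC_derivMixedω` — (CONV-C) FOR A MIXED SECOND-ORDER u-ROW (`b ≠ b′`), ANALYTIC ROUTE ON THE BIDISC** [our proof]: complex entry
families `F k p q : ℂ × ℂ → ℂ` JOINTLY holomorphic on `ball 0 ρ ×ˢ ball 0 ρ` with `‖F k p q‖ ≤ B` there (uniformly in `(k,p,q)`; `0 < B`), value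
rate `c·θ^k` on the real square `[0,s₁]²` (uniformly in `(p,q)`), real kernels `d2F k p q` IDENTIFIED with the mixed derivatives at the base point
(`(d2F k p q : ℂ) = deriv (t ↦ deriv (s ↦ F k p q (s,t)) 0) 0`) and obeying the (H2)-ker decay (`δ₂ ≥ 0`): for all `r, r′ ∈ ]0,1]`, `τ ∈ [0,1]`,
`ConvC d2F (max C₂ (M^{1−τ}(2C₂)^τ)) (τδ₂) (((θ^{1−r})^{1−r′})^{1−τ})`, `M` = PART 8's `derivMixed_step_rateω` constant. -/
theorem convC_derivMixedω {F : ℕ → K D N → K D N → ℂ × ℂ → ℂ} {d2F : ℕ → K D N → K D N → ℝ} {ρ s₁ B c θ C₂ δ₂ : ℝ}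
    (hs₁ : 0 < s₁) (hs₁ρ : s₁ * Real.cosh 1 < ρ)
    (hF : ∀ k p q, DifferentiableOn ℂ (F k p q) (ball (0 : ℂ) ρ ×ˢ ball (0 : ℂ) ρ))
    (hB : ∀ k p q, ∀ z ∈ ball (0 : ℂ) ρ ×ˢ ball (0 : ℂ) ρ, ‖F k p q z‖ ≤ B) (hB0 : 0 < B)
    (hval : ∀ k p q (s t : ℝ), 0 ≤ s → s ≤ s₁ → 0 ≤ t → t ≤ s₁ →
      ‖F (k + 1) p q ((s : ℂ), (t : ℂ)) - F k p q ((s : ℂ), (t : ℂ))‖ ≤ c * θ ^ k)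
    (hc : 0 < c) (hθ : 0 < θ)
    (hd2F : ∀ k p q, (d2F k p q : ℂ) = deriv (fun t : ℂ => deriv (fun s : ℂ => F k p q (s, t)) 0) 0)
    (hdecay : ∀ k (p q : K D N), |d2F k p q| ≤ C₂ * Real.exp (-(δ₂ * dist p.1 q.1))) (hδ₂ : 0 ≤ δ₂)
    {r r' τ : ℝ} (hr : 0 < r) (hr1 : r ≤ 1) (hr' : 0 < r') (hr'1 : r' ≤ 1) (hτ0 : 0 ≤ τ) (hτ1 : τ ≤ 1) :
    ConvC d2F (max C₂ ((25 * (2 * (4 * B / ρ)) ^ r' / (s₁ * r' ^ 2)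
        * (25 * (2 * B) ^ r / (s₁ * r ^ 2) * c ^ (1 - r)) ^ (1 - r')) ^ (1 - τ) * (2 * C₂) ^ τ))
      (τ * δ₂) (((θ ^ (1 - r)) ^ (1 - r')) ^ (1 - τ)) := by
  have hρ : 0 < ρ := rho_pos hs₁ hs₁ρ
  refine convC_of_rate_of_decay hdecay (fun k p q => ?_) ?_
    (Real.rpow_nonneg (Real.rpow_nonneg hθ.le _) _) hδ₂ hτ0 hτ1
  · rw [abs_sub_eq_norm_of_ofReal_eq (hd2F (k + 1) p q) (hd2F k p q)]
    exact derivMixed_step_rateω (F := fun k => F k p q) hs₁ hs₁ρ (fun k => hF k p q) (fun k => hB k p q) hB0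
      (fun k s t hs0 hs1 ht0 ht1 => hval k p q s t hs0 hs1 ht0 ht1) hc hθ hr hr1 hr' hr'1 k
  · have h1 : 0 ≤ (2 * (4 * B / ρ)) ^ r' := Real.rpow_nonneg (by positivity) _
    have h2 : 0 ≤ (25 * (2 * B) ^ r / (s₁ * r ^ 2) * c ^ (1 - r)) ^ (1 - r') :=
      Real.rpow_nonneg (const₁_pos hs₁ hB0 hc hr).le _
    positivity

end AnalyticEnds

/-! ## §4 The ∃-currency ENDs (`∃ C₄ δ₄ θ₄, 0 < δ₄ ∧ 0 ≤ θ₄ ∧ θ₄ < 1 ∧ ConvC …`) -/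

section ExistsEnds

variable {D N : ℕ}

/-- [folklore] `0 < θ < 1` ⇒ `0 ≤ (θ^{1∕2})^{1∕2} < 1` and `0 ≤ ((θ^{1∕2})^{1∕2})^{1∕2} < 1` — the witnesses' ratios. -/
theorem half_ratios {θ : ℝ} (h0 : 0 < θ) (h1 : θ < 1) :
    (θ ^ (1 - 1 / 2 : ℝ)) ^ (1 - 1 / 2 : ℝ) < 1 ∧ ((θ ^ (1 - 1 / 2 : ℝ)) ^ (1 - 1 / 2 : ℝ)) ^ (1 - 1 / 2 : ℝ) < 1 := by
  have a : θ ^ (1 - 1 / 2 : ℝ) < 1 := Real.rpow_lt_one h0.le h1 (by norm_num)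
  have b : (θ ^ (1 - 1 / 2 : ℝ)) ^ (1 - 1 / 2 : ℝ) < 1 := Real.rpow_lt_one (Real.rpow_nonneg h0.le _) a (by norm_num)
  exact ⟨b, Real.rpow_lt_one (Real.rpow_nonneg (Real.rpow_nonneg h0.le _) _) b (by norm_num)⟩

/-- **`exists_convC_derivω` — FIRST-ORDER u-ROW, ∃-CURRENCY** [our proof]: under the hypotheses of `convC_derivω` with `θ < 1` and `0 < δ₂`,
`∃ C₄ δ₄ θ₄, 0 < δ₄ ∧ 0 ≤ θ₄ ∧ θ₄ < 1 ∧ ConvC dF C₄ δ₄ θ₄` (witness `r = τ = ½`: `θ₄ = (θ^{1∕2})^{1∕2}`, `δ₄ = δ₂∕2`). -/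
theorem exists_convC_derivω {F : ℕ → K D N → K D N → ℂ → ℂ} {dF : ℕ → K D N → K D N → ℝ} {ρ s₁ B c θ C₂ δ₂ : ℝ}
    (hs₁ : 0 < s₁) (hs₁ρ : s₁ * Real.cosh 1 < ρ)
    (hF : ∀ k p q, DifferentiableOn ℂ (F k p q) (ball (0 : ℂ) ρ))
    (hB : ∀ k p q, ∀ z ∈ ball (0 : ℂ) ρ, ‖F k p q z‖ ≤ B) (hB0 : 0 ≤ B)
    (hval : ∀ k p q (s : ℝ), 0 ≤ s → s ≤ s₁ → ‖F (k + 1) p q (s : ℂ) - F k p q (s : ℂ)‖ ≤ c * θ ^ k)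
    (hc : 0 < c) (hθ : 0 < θ) (hθ1 : θ < 1)
    (hdF : ∀ k p q, (dF k p q : ℂ) = deriv (F k p q) 0)
    (hdecay : ∀ k (p q : K D N), |dF k p q| ≤ C₂ * Real.exp (-(δ₂ * dist p.1 q.1))) (hδ₂ : 0 < δ₂) :
    ∃ C₄ δ₄ θ₄ : ℝ, 0 < δ₄ ∧ 0 ≤ θ₄ ∧ θ₄ < 1 ∧ ConvC dF C₄ δ₄ θ₄ := by
  have h := convC_derivω hs₁ hs₁ρ hF hB hB0 hval hc hθ hdF hdecay hδ₂.le (r := 1 / 2) (τ := 1 / 2)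
    (by norm_num) (by norm_num) (by norm_num) (by norm_num)
  refine ⟨_, _, _, ?_, ?_, ?_, h⟩
  · positivity
  · exact Real.rpow_nonneg (Real.rpow_nonneg hθ.le _) _
  · exact (half_ratios hθ hθ1).1

/-- **`exists_convC_derivMixedω` — MIXED SECOND-ORDER u-ROW, ∃-CURRENCY** [our proof]: under the hypotheses of `convC_derivMixedω` with `θ < 1`
and `0 < δ₂`, `∃ C₄ δ₄ θ₄, 0 < δ₄ ∧ 0 ≤ θ₄ ∧ θ₄ < 1 ∧ ConvC d2F C₄ δ₄ θ₄` (witness `r = r′ = τ = ½`: `θ₄ = ((θ^{1∕2})^{1∕2})^{1∕2}`, `δ₄ = δ₂∕2`). -/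
theorem exists_convC_derivMixedω {F : ℕ → K D N → K D N → ℂ × ℂ → ℂ} {d2F : ℕ → K D N → K D N → ℝ} {ρ s₁ B c θ C₂ δ₂ : ℝ}
    (hs₁ : 0 < s₁) (hs₁ρ : s₁ * Real.cosh 1 < ρ)
    (hF : ∀ k p q, DifferentiableOn ℂ (F k p q) (ball (0 : ℂ) ρ ×ˢ ball (0 : ℂ) ρ))
    (hB : ∀ k p q, ∀ z ∈ ball (0 : ℂ) ρ ×ˢ ball (0 : ℂ) ρ, ‖F k p q z‖ ≤ B) (hB0 : 0 < B)
    (hval : ∀ k p q (s t : ℝ), 0 ≤ s → s ≤ s₁ → 0 ≤ t → t ≤ s₁ →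
      ‖F (k + 1) p q ((s : ℂ), (t : ℂ)) - F k p q ((s : ℂ), (t : ℂ))‖ ≤ c * θ ^ k)
    (hc : 0 < c) (hθ : 0 < θ) (hθ1 : θ < 1)
    (hd2F : ∀ k p q, (d2F k p q : ℂ) = deriv (fun t : ℂ => deriv (fun s : ℂ => F k p q (s, t)) 0) 0)
    (hdecay : ∀ k (p q : K D N), |d2F k p q| ≤ C₂ * Real.exp (-(δ₂ * dist p.1 q.1))) (hδ₂ : 0 < δ₂) :
    ∃ C₄ δ₄ θ₄ : ℝ, 0 < δ₄ ∧ 0 ≤ θ₄ ∧ θ₄ < 1 ∧ ConvC d2F C₄ δ₄ θ₄ := by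
  have h := convC_derivMixedω hs₁ hs₁ρ hF hB hB0 hval hc hθ hd2F hdecay hδ₂.le (r := 1 / 2) (r' := 1 / 2) (τ := 1 / 2)
    (by norm_num) (by norm_num) (by norm_num) (by norm_num) (by norm_num) (by norm_num)
  refine ⟨_, _, _, ?_, ?_, ?_, h⟩
  · positivity
  · exact Real.rpow_nonneg (Real.rpow_nonneg (Real.rpow_nonneg hθ.le _) _) _
  · exact (half_ratios hθ hθ1).2

end ExistsEnds

end Summit.QuantumFields.BalabanUV.Beta.GAN24.DerivativeRateTransferAnalyticConvC

end
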